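import Summits.Ventures.CertifiedManyBodySolver.Observables.RungLeavesCoverageNdNiO2M22ResidualBundles
import HarnessLib

/-!
# Ventures/CertifiedManyBodySolver — Observables/RungLeavesCoverageNdNiO2M22ResidualBundlesSlabs.lean

HONEST FRAMING: one-sided certified CEILINGS on the uniform flux stiffness on the DOWNFOLDED d⁹-nickelate box of record `boxNdSrNiO2E_M22`
(Nd₀.₈Sr₀.₂NiO₂; router/BOXES/NdNiO2.md «1BH+3BE», SCREENING-GRADE) — wording class (xx1): CONTROL / CALIBRATION + labelled heuristic; a ceiling never
speaks to the presence or absence of superconductivity; never «certified true negative / positive»; not a `T_c` or phase-diagram statement; nothing here is a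
statement about Nd₀.₈Sr₀.₂NiO₂ samples; no rung leaf, item or summit statement is proved here. CONDITIONAL closers only (conditional BY NAME on the bundle rows and
cap tables named); floors and the `Q`-objective rows discharged inside (kernel theorems); no number of record; no `sorry`; no definition; zero compute.
Label (captain hubbard-cov-ndnio2-plan-1 g3): readiness plumbing, CONDITIONAL by name on rows not yet solved; no number of record; no route opened here.

Cells `pub/hubbard-obs` ∧ `pub/hubbard-downfold` (MO-S2 ∧ MO-S1, D-0154 (1)(C) COVERAGE material (iii) NdNiO₂, column M22), seat `hubbard-cov-ndnio2-unc-3`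
(`prover-hubbard-cov-ndnio2-unc-3-g5-0`). Second part of `Observables/RungLeavesCoverageNdNiO2M22ResidualBundles.lean` (the ONE-SLAB closer `U ∈ [5, 17/2]`
from three `P` bundle rows). Director-hubbard ORDER «M22-LITE-3» (ladder REQUESTS 2026-08-28T19:49:21Z) names the PEN's route recipe LIKE-FOR-LIKE with
`CovNdNiO2M21`: two slab cruxes `ResidualLowUSlab22` (`U ∈ [5, 13/2]`) / `ResidualHighUSlab22` (`U ∈ [13/2, 17/2]`) on `t′ ∈ [−23/50, −11/25] × n ∈ [393/500, 409/500]`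
at `c = 4418857/10⁷` (captain relay hubbard-obs STATUS 2026-08-28T19:52:04Z (6)). This file types the two SLAB statements in the same currency:

* §4 LOW slab `U ∈ [5, 13/2]`: `ndM22_residualLowUSlab_of_PbundleRowsWN_capTables` — the one-slab closer of part 1 restricted (three `P` rows A / B / C; the
  like-for-like M21 low slab also carries three nodes).
* §5 HIGH slab `U ∈ [13/2, 17/2]` WITH TWO ROWS ONLY (node economy, as M21's `ResidualHighUSlab` p658251): sources `s ∈ [σ·24/17, σ·16/13] ⊂ [−276/425, −176/325]`
  lie in A ∪ B, so the `P` rows on A (whole) and B (used on `[−11/20, −176/325]`) suffice: `ndM22_station5_family2_of_bundleRowsWN`,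
  `ndM22_residualHighUSlab_of_bundleRowsWN` (four rows A/B × P/Q + windows + 12 end prices, via unc-2's
  `ObsStiffnessSeqCeilingAt_on_highSlab_of_apexStation_twoEndObjectives` with `(U_A, U₁, U_max) = (5, 13/2, 17/2)` per density), `…_capTables`, and
  `ndM22_residualHighUSlab_of_PbundleRowsWN_capTables` (TWO `P` rows; `Q` by part 1 §2).

NOT said: that any M22 bundle certificate exists (hubs H1–H3 fired 2026-08-28T19:52Z; no row is solved at the time of writing); which crux wording the PEN files;
a number of record. With the nodes typed, each slab crux is ONE `exact` — CLOSED MODULO NODES, never ‹proved› while the rows are claims.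

References: Boyd–Vandenberghe, *Convex Optimization* (2004) §5.9 [BoydVandenberghe2004]; Koma–Tasaki, J. Stat. Phys. 76 (1994) 745, §1 [KomaTasaki1994];
Scalapino–White–Zhang, PRB 47 (1993) 7995, §II [ScalapinoWhiteZhang1993]; Lieb–Loss, Duke Math. J. 71 (1993) 337, §8 Thm 8.2 [LiebLoss1993]; Israel, *Convexity in
the Theory of Lattice Gases* (1979) Thm. I.3.4 [Israel1979]; Hazra–Verma–Randeria, PRX 9 (2019) 031049, eq. (4) [HazraVermaRanderia2019].
-/

noncomputable section

namespace Summit.Ventures.CertifiedManyBodySolver.Observables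

open Set Filter Topology
open Summit.Ventures.CertifiedManyBodySolver.Downfold
open Summit.Ventures.CertifiedManyBodySolver.Certificates
open Literature.MathematicalPhysics.QuantumLattice Literature.MathematicalPhysics.QuantumLattice.ThermodynamicLimit
open Literature.Probability.LatticeModels
open Matrix HubbardWave0
open scoped BigOperators ComplexOrder

/-! ## §4 The LOW slab `U ∈ [5, 13/2]` (three `P` rows; restriction of the one-slab closer) -/

section LowSlab22

/-- **`ResidualLowUSlab22` SHAPE FROM THE THREE `P` BUNDLE ROWS** (station 5, cap TABLES in binder shape; the `Q` slots by `ndM22_QRowWN_kinematic`): the hypotheses of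
`ndM22_residual_of_PbundleRowsWN_capTables` ⇒ `∀ tp ∈ [−23/50, −11/25], ∀ U ∈ [5, 13/2], ∀ n ∈ [393/500, 409/500], ObsStiffnessSeqCeilingAt tp U n c` (the one-slab
statement restricted to `U ≤ 13/2 ≤ 17/2`). [cite: KomaTasaki1994, §1] [cite: ScalapinoWhiteZhang1993, §II] -/
theorem ndM22_residualLowUSlab_of_PbundleRowsWN_capTables {sA₁ sA₂ sB₁ sB₂ sC₁ sC₂ aA bA nA nTA CA aB bB nB nTB CB aC bC nC nTC CC : ℝ}
    {loPA hiPA FPA sPA₁ sPA₂ loPB hiPB FPB sPB₁ sPB₂ loPC hiPC FPC sPC₁ sPC₂ c : ℚ}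
    (hPA : TPrimeBundleOrbitLowerRowWN 5 sA₁ sA₂ loPA hiPA FPA sPA₁ sPA₂ (409 / 500) (fun _ => -oddMomentObsTT (-23 / 50) 5 0))
    (hPB : TPrimeBundleOrbitLowerRowWN 5 sB₁ sB₂ loPB hiPB FPB sPB₁ sPB₂ (409 / 500) (fun _ => -oddMomentObsTT (-23 / 50) 5 0))
    (hPC : TPrimeBundleOrbitLowerRowWN 5 sC₁ sC₂ loPC hiPC FPC sPC₁ sPC₂ (409 / 500) (fun _ => -oddMomentObsTT (-23 / 50) 5 0))
    (hA₁ : sA₁ ≤ -(276 / 425)) (hA₂ : (-11 / 20 : ℝ) ≤ sA₂) (hB₁ : sB₁ ≤ -11 / 20) (hB₂ : (-23 / 50 : ℝ) ≤ sB₂)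
    (hC₁ : sC₁ ≤ -23 / 50) (hC₂ : (-11 / 25 : ℝ) ≤ sC₂)
    (hcapA : ∀ U s n : ℝ, 0 ≤ U → U ≤ 5 → aA ≤ s → s ≤ bA → nA ≤ n → n ≤ nTA → energyDensityTT' 1 s U n ≤ CA)
    (hcapB : ∀ U s n : ℝ, 0 ≤ U → U ≤ 5 → aB ≤ s → s ≤ bB → nB ≤ n → n ≤ nTB → energyDensityTT' 1 s U n ≤ CB)
    (hcapC : ∀ U s n : ℝ, 0 ≤ U → U ≤ 5 → aC ≤ s → s ≤ bC → nC ≤ n → n ≤ nTC → energyDensityTT' 1 s U n ≤ CC)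
    (haA : aA ≤ -(276 / 425)) (hbA : (-11 / 20 : ℝ) ≤ bA) (hnA : nA ≤ 393 / 500) (hnTA : (409 / 500 : ℝ) ≤ nTA)
    (haB : aB ≤ -11 / 20) (hbB : (-23 / 50 : ℝ) ≤ bB) (hnB : nB ≤ 393 / 500) (hnTB : (409 / 500 : ℝ) ≤ nTB)
    (haC : aC ≤ -23 / 50) (hbC : (-11 / 25 : ℝ) ≤ bC) (hnC : nC ≤ 393 / 500) (hnTC : (409 / 500 : ℝ) ≤ nTC)
    (hloPA : loPA ≤ -112884 / 53125) (hloPB : loPB ≤ -4499 / 2500) (hloPC : loPC ≤ -5726 / 3125)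
    (hhiPA : CA ≤ ((hiPA : ℚ) : ℝ)) (hhiPB : CB ≤ ((hiPB : ℚ) : ℝ)) (hhiPC : CC ≤ ((hiPC : ℚ) : ℝ))
    (pPA : -FPA - sPA₁ * (393 / 500 - 409 / 500) ≤ c ∧ -FPA - sPA₂ * (393 / 500 - 409 / 500) ≤ c ∧ -FPA ≤ c)
    (pPB : -FPB - sPB₁ * (393 / 500 - 409 / 500) ≤ c ∧ -FPB - sPB₂ * (393 / 500 - 409 / 500) ≤ c ∧ -FPB ≤ c)
    (pPC : -FPC - sPC₁ * (393 / 500 - 409 / 500) ≤ c ∧ -FPC - sPC₂ * (393 / 500 - 409 / 500) ≤ c ∧ -FPC ≤ c)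
    (hcQ : (4418570 / 10000000 : ℚ) ≤ c) :
    ∀ tp ∈ Set.Icc (-23 / 50 : ℝ) (-11 / 25), ∀ U ∈ Set.Icc (5 : ℝ) (13 / 2), ∀ n ∈ Set.Icc (393 / 500 : ℝ) (409 / 500),
      ObsStiffnessSeqCeilingAt tp U n c :=
  fun tp htp U hU n hn =>
    ndM22_residual_of_PbundleRowsWN_capTables hPA hPB hPC hA₁ hA₂ hB₁ hB₂ hC₁ hC₂ hcapA hcapB hcapC haA hbA hnA hnTA haB hbB hnB hnTB
      haC hbC hnC hnTC hloPA hloPB hloPC hhiPA hhiPB hhiPC pPA pPB pPC hcQ tp htp U ⟨hU.1, hU.2.trans (by norm_num)⟩ n hn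

end LowSlab22

/-! ## §5 The HIGH slab `U ∈ [13/2, 17/2]` from TWO rows (A whole, B used on `[−11/20, −176/325]`) -/

section HighSlab22

/-- The station-5 high-slab segment ends: `(−23/50)(2 − 5/(17/2)) = −276/425` and `(−11/25)(2 − 5/(13/2)) = −176/325`. [folklore] -/
theorem ndM22_station5_highSlab_segment_ends :
    (-23 / 50 : ℝ) * (2 - (5 : ℝ) / (17 / 2 : ℝ)) = -(276 / 425) ∧ (-11 / 25 : ℝ) * (2 - (5 : ℝ) / (13 / 2 : ℝ)) = -(176 / 325) := by
  constructor <;> norm_num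

/-- **TWO-PIECE FAMILY for one objective slot `σ`** (station `U_A = 5`, anchor `409/500`): bundle rows on `[sA₁, sA₂] ⊇ [a, −11/20]` and `[sB₁, sB₂] ⊇ [−11/20, b]` for
`−X₀(σ, 5)`, each with its window DISCHARGED on (used segment) × R₂₂ ⇒ at every `x ∈ R₂₂`, `s ∈ [a, b]` the value `if s ≤ −11/20 then wnBundleValue_A x else wnBundleValue_B x`
is an orbit-LOWER bound on the torus-limit ground-state class at `(s, 5, x)`. [cite: BoydVandenberghe2004, §5.9] [cite: KomaTasaki1994, §1] -/
theorem ndM22_station5_family2_of_bundleRowsWN (σ : ℝ) {a b sA₁ sA₂ sB₁ sB₂ : ℝ} {loA hiA FA slA₁ slA₂ loB hiB FB slB₁ slB₂ : ℚ}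
    (hA : TPrimeBundleOrbitLowerRowWN 5 sA₁ sA₂ loA hiA FA slA₁ slA₂ (409 / 500) (fun _ => -oddMomentObsTT σ 5 0))
    (hB : TPrimeBundleOrbitLowerRowWN 5 sB₁ sB₂ loB hiB FB slB₁ slB₂ (409 / 500) (fun _ => -oddMomentObsTT σ 5 0))
    (haA : sA₁ ≤ a) (hA₂ : (-11 / 20 : ℝ) ≤ sA₂) (hB₁ : sB₁ ≤ -11 / 20) (hbB : b ≤ sB₂)
    (hwinA : ∀ s ∈ Set.Icc a (-11 / 20), ∀ x ∈ Set.Icc (393 / 500 : ℝ) (409 / 500),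
      ((loA : ℚ) : ℝ) ≤ energyDensityTT' 1 s 5 x ∧ energyDensityTT' 1 s 5 x ≤ ((hiA : ℚ) : ℝ))
    (hwinB : ∀ s ∈ Set.Icc (-11 / 20 : ℝ) b, ∀ x ∈ Set.Icc (393 / 500 : ℝ) (409 / 500),
      ((loB : ℚ) : ℝ) ≤ energyDensityTT' 1 s 5 x ∧ energyDensityTT' 1 s 5 x ≤ ((hiB : ℚ) : ℝ)) :
    ∀ x ∈ Set.Icc (393 / 500 : ℝ) (409 / 500), ∀ s ∈ Set.Icc a b,
      ∀ (ω : InfVolFermionState 2) (Ls : ℕ → ℕ) (ψ : ∀ L, Fock (Orb (FermionTorus 2 L))),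
      Tendsto Ls atTop atTop →
      (∀ j, IsGroundStateInSector (hubbardTorusTT' (Ls j) 1 s 5) (rectN x (Ls j)) 0 (ψ (Ls j))) →
      (∀ j, star (ψ (Ls j)) ⬝ᵥ ψ (Ls j) = 1) → ω.IsTorusLimitOf ψ Ls →
      (if s ≤ -11 / 20 then wnBundleValue FA slA₁ slA₂ (409 / 500) x else wnBundleValue FB slB₁ slB₂ (409 / 500) x) ≤
        ((Finset.univ : Finset (DihedralGroup 4)).card : ℝ)⁻¹ * ∑ g ∈ (Finset.univ : Finset (DihedralGroup 4)),
          (ω.expect (d4ShiftSet g 0 (Literature.Probability.LatticeModels.box 2 7))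
            (fermionEmbed (PolySite.d4Emb g 0 (Literature.Probability.LatticeModels.box 2 7)) (-oddMomentObsTT σ 5 0))).re := by
  intro x hx s hs ω Ls ψ hLs hψ h1 hω
  have fA := orbitLowerOn_subrect_of_bundleRowWN hA haA hA₂ (by norm_num : (0 : ℝ) ≤ 393 / 500) (by norm_num : (409 / 500 : ℝ) < 2) hwinA
  have fB := orbitLowerOn_subrect_of_bundleRowWN hB hB₁ hbB (by norm_num : (0 : ℝ) ≤ 393 / 500) (by norm_num : (409 / 500 : ℝ) < 2) hwinB
  by_cases hs1 : s ≤ -11 / 20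
  · simp only [if_pos hs1]
    exact fA x hx s ⟨hs.1, hs1⟩ ω Ls ψ hLs hψ h1 hω
  · simp only [if_neg hs1]
    exact fB x hx s ⟨(not_le.1 hs1).le, hs.2⟩ ω Ls ψ hLs hψ h1 hω

/-- **CONDITIONAL CLOSER OF THE M22 HIGH SLAB FROM FOUR BUNDLE ROWS** (station `U_A = 5`, `U₁ = 13/2`, `U_max = 17/2`, sources `[−276/425, −176/325]`, anchor `409/500`):
rows `P`/`Q` on A `[sA₁, sA₂] ⊇ [−276/425, −11/20]` and B `⊇ [−11/20, −176/325]`; windows as ∀-hypotheses on the USED rectangles; 12 end prices `≤ c` ⇒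
`∀ tp ∈ [−23/50, −11/25], ∀ U ∈ [13/2, 17/2], ∀ n ∈ [393/500, 409/500], ObsStiffnessSeqCeilingAt tp U n c` (unc-2's `ObsStiffnessSeqCeilingAt_on_highSlab_of_apexStation_twoEndObjectives`
per density). CONDITIONAL on the rows and windows; no number asserted. [cite: KomaTasaki1994, §1] [cite: ScalapinoWhiteZhang1993, §II] [cite: HazraVermaRanderia2019, eq. (4)] -/
theorem ndM22_residualHighUSlab_of_bundleRowsWN {sA₁ sA₂ sB₁ sB₂ : ℝ}
    {loPA hiPA FPA sPA₁ sPA₂ loQA hiQA FQA sQA₁ sQA₂ loPB hiPB FPB sPB₁ sPB₂ loQB hiQB FQB sQB₁ sQB₂ c : ℚ}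
    (hPA : TPrimeBundleOrbitLowerRowWN 5 sA₁ sA₂ loPA hiPA FPA sPA₁ sPA₂ (409 / 500) (fun _ => -oddMomentObsTT (-23 / 50) 5 0))
    (hQA : TPrimeBundleOrbitLowerRowWN 5 sA₁ sA₂ loQA hiQA FQA sQA₁ sQA₂ (409 / 500) (fun _ => -oddMomentObsTT (-11 / 25) 5 0))
    (hPB : TPrimeBundleOrbitLowerRowWN 5 sB₁ sB₂ loPB hiPB FPB sPB₁ sPB₂ (409 / 500) (fun _ => -oddMomentObsTT (-23 / 50) 5 0))
    (hQB : TPrimeBundleOrbitLowerRowWN 5 sB₁ sB₂ loQB hiQB FQB sQB₁ sQB₂ (409 / 500) (fun _ => -oddMomentObsTT (-11 / 25) 5 0))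
    (hA₁ : sA₁ ≤ -(276 / 425)) (hA₂ : (-11 / 20 : ℝ) ≤ sA₂) (hB₁ : sB₁ ≤ -11 / 20) (hB₂ : (-(176 / 325) : ℝ) ≤ sB₂)
    (hwinPA : ∀ s ∈ Set.Icc (-(276 / 425) : ℝ) (-11 / 20), ∀ x ∈ Set.Icc (393 / 500 : ℝ) (409 / 500),
      ((loPA : ℚ) : ℝ) ≤ energyDensityTT' 1 s 5 x ∧ energyDensityTT' 1 s 5 x ≤ ((hiPA : ℚ) : ℝ))
    (hwinQA : ∀ s ∈ Set.Icc (-(276 / 425) : ℝ) (-11 / 20), ∀ x ∈ Set.Icc (393 / 500 : ℝ) (409 / 500),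
      ((loQA : ℚ) : ℝ) ≤ energyDensityTT' 1 s 5 x ∧ energyDensityTT' 1 s 5 x ≤ ((hiQA : ℚ) : ℝ))
    (hwinPB : ∀ s ∈ Set.Icc (-11 / 20 : ℝ) (-(176 / 325)), ∀ x ∈ Set.Icc (393 / 500 : ℝ) (409 / 500),
      ((loPB : ℚ) : ℝ) ≤ energyDensityTT' 1 s 5 x ∧ energyDensityTT' 1 s 5 x ≤ ((hiPB : ℚ) : ℝ))
    (hwinQB : ∀ s ∈ Set.Icc (-11 / 20 : ℝ) (-(176 / 325)), ∀ x ∈ Set.Icc (393 / 500 : ℝ) (409 / 500),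
      ((loQB : ℚ) : ℝ) ≤ energyDensityTT' 1 s 5 x ∧ energyDensityTT' 1 s 5 x ≤ ((hiQB : ℚ) : ℝ))
    (pPA : -FPA - sPA₁ * (393 / 500 - 409 / 500) ≤ c ∧ -FPA - sPA₂ * (393 / 500 - 409 / 500) ≤ c ∧ -FPA ≤ c)
    (pQA : -FQA - sQA₁ * (393 / 500 - 409 / 500) ≤ c ∧ -FQA - sQA₂ * (393 / 500 - 409 / 500) ≤ c ∧ -FQA ≤ c)
    (pPB : -FPB - sPB₁ * (393 / 500 - 409 / 500) ≤ c ∧ -FPB - sPB₂ * (393 / 500 - 409 / 500) ≤ c ∧ -FPB ≤ c)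
    (pQB : -FQB - sQB₁ * (393 / 500 - 409 / 500) ≤ c ∧ -FQB - sQB₂ * (393 / 500 - 409 / 500) ≤ c ∧ -FQB ≤ c) :
    ∀ tp ∈ Set.Icc (-23 / 50 : ℝ) (-11 / 25), ∀ U ∈ Set.Icc (13 / 2 : ℝ) (17 / 2), ∀ n ∈ Set.Icc (393 / 500 : ℝ) (409 / 500),
      ObsStiffnessSeqCeilingAt tp U n c := by
  intro tp htp U hU n hn
  obtain ⟨eL, eR⟩ := ndM22_station5_highSlab_segment_ends
  have fP := ndM22_station5_family2_of_bundleRowsWN (-23 / 50) hPA hPB hA₁ hA₂ hB₁ hB₂ hwinPA hwinPB n hn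
  have fQ := ndM22_station5_family2_of_bundleRowsWN (-11 / 25) hQA hQB hA₁ hA₂ hB₁ hB₂ hwinQA hwinQB n hn
  have cPA := neg_wnBundleValue_le_on_R22_of_ends pPA.1 pPA.2.1 pPA.2.2 n hn
  have cQA := neg_wnBundleValue_le_on_R22_of_ends pQA.1 pQA.2.1 pQA.2.2 n hn
  have cPB := neg_wnBundleValue_le_on_R22_of_ends pPB.1 pPB.2.1 pPB.2.2 n hn
  have cQB := neg_wnBundleValue_le_on_R22_of_ends pQB.1 pQB.2.1 pQB.2.2 n hn
  refine ObsStiffnessSeqCeilingAt_on_highSlab_of_apexStation_twoEndObjectives (p := -23 / 50) (q := -11 / 25) (UA := (5 : ℝ))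
    (U₁ := (13 / 2 : ℝ)) (Umax := (17 / 2 : ℝ)) (n := n) (by norm_num) (by norm_num) (by norm_num) (by norm_num)
    (by linarith [hn.1]) (by linarith [hn.2])
    (fun s => if s ≤ -11 / 20 then wnBundleValue FPA sPA₁ sPA₂ (409 / 500) n else wnBundleValue FPB sPB₁ sPB₂ (409 / 500) n)
    (fun s => if s ≤ -11 / 20 then wnBundleValue FQA sQA₁ sQA₂ (409 / 500) n else wnBundleValue FQB sQB₁ sQB₂ (409 / 500) n)
    c ?_ ?_ ?_ tp htp U hU
  · intro s hs
    rw [eL, eR] at hs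
    exact fP s hs
  · intro s hs
    rw [eL, eR] at hs
    exact fQ s hs
  · intro σ hσ s _
    refine neg_slotChord_le_of_neg_le (by norm_num) hσ ?_ ?_
    · by_cases hs1 : s ≤ -11 / 20
      · simp only [if_pos hs1]; exact cPA
      · simp only [if_neg hs1]; exact cPB
    · by_cases hs1 : s ≤ -11 / 20
      · simp only [if_pos hs1]; exact cQA
      · simp only [if_neg hs1]; exact cQB

/-- **THE M22 HIGH SLAB over cap TABLES (station 5).** Four bundle rows as in `ndM22_residualHighUSlab_of_bundleRowsWN`; two cap tables in binder shape on `[aA, bA] ⊇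
[−276/425, −11/20]`, `[aB, bB] ⊇ [−11/20, −176/325]` (`U ≤ 5`, fillings `nX ≤ 393/500 ≤ 409/500 ≤ nTX`); thresholds `lo ≤ −112884/53125 | −4499/2500`, `CX ≤ hi`; 12 end prices
⇒ the high-slab statement at `c`. [cite: KomaTasaki1994, §1] [cite: ScalapinoWhiteZhang1993, §II] -/
theorem ndM22_residualHighUSlab_of_bundleRowsWN_capTables {sA₁ sA₂ sB₁ sB₂ aA bA nA nTA CA aB bB nB nTB CB : ℝ}
    {loPA hiPA FPA sPA₁ sPA₂ loQA hiQA FQA sQA₁ sQA₂ loPB hiPB FPB sPB₁ sPB₂ loQB hiQB FQB sQB₁ sQB₂ c : ℚ}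
    (hPA : TPrimeBundleOrbitLowerRowWN 5 sA₁ sA₂ loPA hiPA FPA sPA₁ sPA₂ (409 / 500) (fun _ => -oddMomentObsTT (-23 / 50) 5 0))
    (hQA : TPrimeBundleOrbitLowerRowWN 5 sA₁ sA₂ loQA hiQA FQA sQA₁ sQA₂ (409 / 500) (fun _ => -oddMomentObsTT (-11 / 25) 5 0))
    (hPB : TPrimeBundleOrbitLowerRowWN 5 sB₁ sB₂ loPB hiPB FPB sPB₁ sPB₂ (409 / 500) (fun _ => -oddMomentObsTT (-23 / 50) 5 0))
    (hQB : TPrimeBundleOrbitLowerRowWN 5 sB₁ sB₂ loQB hiQB FQB sQB₁ sQB₂ (409 / 500) (fun _ => -oddMomentObsTT (-11 / 25) 5 0))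
    (hA₁ : sA₁ ≤ -(276 / 425)) (hA₂ : (-11 / 20 : ℝ) ≤ sA₂) (hB₁ : sB₁ ≤ -11 / 20) (hB₂ : (-(176 / 325) : ℝ) ≤ sB₂)
    (hcapA : ∀ U s n : ℝ, 0 ≤ U → U ≤ 5 → aA ≤ s → s ≤ bA → nA ≤ n → n ≤ nTA → energyDensityTT' 1 s U n ≤ CA)
    (hcapB : ∀ U s n : ℝ, 0 ≤ U → U ≤ 5 → aB ≤ s → s ≤ bB → nB ≤ n → n ≤ nTB → energyDensityTT' 1 s U n ≤ CB)
    (haA : aA ≤ -(276 / 425)) (hbA : (-11 / 20 : ℝ) ≤ bA) (hnA : nA ≤ 393 / 500) (hnTA : (409 / 500 : ℝ) ≤ nTA)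
    (haB : aB ≤ -11 / 20) (hbB : (-(176 / 325) : ℝ) ≤ bB) (hnB : nB ≤ 393 / 500) (hnTB : (409 / 500 : ℝ) ≤ nTB)
    (hloPA : loPA ≤ -112884 / 53125) (hloQA : loQA ≤ -112884 / 53125) (hloPB : loPB ≤ -4499 / 2500) (hloQB : loQB ≤ -4499 / 2500)
    (hhiPA : CA ≤ ((hiPA : ℚ) : ℝ)) (hhiQA : CA ≤ ((hiQA : ℚ) : ℝ)) (hhiPB : CB ≤ ((hiPB : ℚ) : ℝ)) (hhiQB : CB ≤ ((hiQB : ℚ) : ℝ))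
    (pPA : -FPA - sPA₁ * (393 / 500 - 409 / 500) ≤ c ∧ -FPA - sPA₂ * (393 / 500 - 409 / 500) ≤ c ∧ -FPA ≤ c)
    (pQA : -FQA - sQA₁ * (393 / 500 - 409 / 500) ≤ c ∧ -FQA - sQA₂ * (393 / 500 - 409 / 500) ≤ c ∧ -FQA ≤ c)
    (pPB : -FPB - sPB₁ * (393 / 500 - 409 / 500) ≤ c ∧ -FPB - sPB₂ * (393 / 500 - 409 / 500) ≤ c ∧ -FPB ≤ c)
    (pQB : -FQB - sQB₁ * (393 / 500 - 409 / 500) ≤ c ∧ -FQB - sQB₂ * (393 / 500 - 409 / 500) ≤ c ∧ -FQB ≤ c) :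
    ∀ tp ∈ Set.Icc (-23 / 50 : ℝ) (-11 / 25), ∀ U ∈ Set.Icc (13 / 2 : ℝ) (17 / 2), ∀ n ∈ Set.Icc (393 / 500 : ℝ) (409 / 500),
      ObsStiffnessSeqCeilingAt tp U n c := by
  have h5 : (0 : ℝ) ≤ 5 := by norm_num
  obtain ⟨flA, flB, -⟩ := ndM22_station5_rectFloors (U := (5 : ℝ)) h5
  have flB' : ∀ s ∈ Set.Icc (-11 / 20 : ℝ) (-(176 / 325)), ∀ x ∈ Set.Icc (393 / 500 : ℝ) (409 / 500),
      (((-4499 / 2500 : ℚ)) : ℝ) ≤ energyDensityTT' 1 s 5 x :=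
    fun s hs x hx => flB s ⟨hs.1, hs.2.trans (by norm_num)⟩ x hx
  exact ndM22_residualHighUSlab_of_bundleRowsWN hPA hQA hPB hQB hA₁ hA₂ hB₁ hB₂
    (bundleWindow_of_capTable_R22 h5 hcapA haA hbA hnA hnTA flA hloPA hhiPA)
    (bundleWindow_of_capTable_R22 h5 hcapA haA hbA hnA hnTA flA hloQA hhiQA)
    (bundleWindow_of_capTable_R22 h5 hcapB haB hbB hnB hnTB flB' hloPB hhiPB)
    (bundleWindow_of_capTable_R22 h5 hcapB haB hbB hnB hnTB flB' hloQB hhiQB)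
    pPA pQA pPB pQB

/-- **THE M22 HIGH SLAB FROM THE TWO `P` BUNDLE ROWS A AND B ONLY** (node economy as M21's `ResidualHighUSlab` p658251; the `Q` slots by `ndM22_QRowWN_kinematic`): `P` rows on
A / B anchored at `409/500` + two cap tables + thresholds + the two `P` end-price triples `≤ c` and `4418570/10⁷ ≤ c` ⇒ `∀ tp ∈ [−23/50, −11/25], ∀ U ∈ [13/2, 17/2],
∀ n ∈ [393/500, 409/500], ObsStiffnessSeqCeilingAt tp U n c` — the form a `ResidualHighUSlab22` closer would `exact` with two bundle claim nodes.
[cite: KomaTasaki1994, §1] [cite: ScalapinoWhiteZhang1993, §II] [cite: LiebLoss1993, §8, Theorem 8.2] -/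
theorem ndM22_residualHighUSlab_of_PbundleRowsWN_capTables {sA₁ sA₂ sB₁ sB₂ aA bA nA nTA CA aB bB nB nTB CB : ℝ}
    {loPA hiPA FPA sPA₁ sPA₂ loPB hiPB FPB sPB₁ sPB₂ c : ℚ}
    (hPA : TPrimeBundleOrbitLowerRowWN 5 sA₁ sA₂ loPA hiPA FPA sPA₁ sPA₂ (409 / 500) (fun _ => -oddMomentObsTT (-23 / 50) 5 0))
    (hPB : TPrimeBundleOrbitLowerRowWN 5 sB₁ sB₂ loPB hiPB FPB sPB₁ sPB₂ (409 / 500) (fun _ => -oddMomentObsTT (-23 / 50) 5 0))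
    (hA₁ : sA₁ ≤ -(276 / 425)) (hA₂ : (-11 / 20 : ℝ) ≤ sA₂) (hB₁ : sB₁ ≤ -11 / 20) (hB₂ : (-(176 / 325) : ℝ) ≤ sB₂)
    (hcapA : ∀ U s n : ℝ, 0 ≤ U → U ≤ 5 → aA ≤ s → s ≤ bA → nA ≤ n → n ≤ nTA → energyDensityTT' 1 s U n ≤ CA)
    (hcapB : ∀ U s n : ℝ, 0 ≤ U → U ≤ 5 → aB ≤ s → s ≤ bB → nB ≤ n → n ≤ nTB → energyDensityTT' 1 s U n ≤ CB)
    (haA : aA ≤ -(276 / 425)) (hbA : (-11 / 20 : ℝ) ≤ bA) (hnA : nA ≤ 393 / 500) (hnTA : (409 / 500 : ℝ) ≤ nTA)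
    (haB : aB ≤ -11 / 20) (hbB : (-(176 / 325) : ℝ) ≤ bB) (hnB : nB ≤ 393 / 500) (hnTB : (409 / 500 : ℝ) ≤ nTB)
    (hloPA : loPA ≤ -112884 / 53125) (hloPB : loPB ≤ -4499 / 2500)
    (hhiPA : CA ≤ ((hiPA : ℚ) : ℝ)) (hhiPB : CB ≤ ((hiPB : ℚ) : ℝ))
    (pPA : -FPA - sPA₁ * (393 / 500 - 409 / 500) ≤ c ∧ -FPA - sPA₂ * (393 / 500 - 409 / 500) ≤ c ∧ -FPA ≤ c)
    (pPB : -FPB - sPB₁ * (393 / 500 - 409 / 500) ≤ c ∧ -FPB - sPB₂ * (393 / 500 - 409 / 500) ≤ c ∧ -FPB ≤ c)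
    (hcQ : (4418570 / 10000000 : ℚ) ≤ c) :
    ∀ tp ∈ Set.Icc (-23 / 50 : ℝ) (-11 / 25), ∀ U ∈ Set.Icc (13 / 2 : ℝ) (17 / 2), ∀ n ∈ Set.Icc (393 / 500 : ℝ) (409 / 500),
      ObsStiffnessSeqCeilingAt tp U n c :=
  ndM22_residualHighUSlab_of_bundleRowsWN_capTables hPA (ndM22_QRowWN_kinematic 5 sA₁ sA₂ loPA hiPA 5) hPB
    (ndM22_QRowWN_kinematic 5 sB₁ sB₂ loPB hiPB 5) hA₁ hA₂ hB₁ hB₂ hcapA hcapB haA hbA hnA hnTA haB hbB hnB hnTB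
    hloPA hloPA hloPB hloPB hhiPA hhiPA hhiPB hhiPB pPA (ndM22_QRowWN_kinematic_prices_of_le hcQ) pPB (ndM22_QRowWN_kinematic_prices_of_le hcQ)

end HighSlab22

end Summit.Ventures.CertifiedManyBodySolver.Observables

end
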